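import Literature.MathematicalPhysics.QuantumFieldTheory.Balaban1983to89.B9Thm311PosAtRecordV4

/-!
# `Balaban1983to89.B9Thm311ProjectionR` — (3.25)'s `R(U)` IS a symmetric IDEMPOTENT at def-Y's v4 letters for every unitary background, and
# (3.26)'s quadratic form decomposes as `⟨A, Δ_a(U)A⟩ = ⟨A, Δ(U)A⟩ + ‖R(U)D\*_UA‖² + ‖Q(U)A‖²_a` — the two gauge-fixing ∕ averaging terms are
# SQUARES; what row 17 of the N06 knit still displays (`Δ_a(U) > 0` on (3.35)) is located on the Hessian `Δ(U)` of the Wilson action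

T. Bałaban, *Propagators for lattice gauge theories in a background field*, Commun. Math. Phys. **99** (1985) 389–434
[`Balaban1985BackgroundPropagators`, "B9"]; [4] = *Propagators … II* [`Balaban1984PropagatorsII`].

statement-level skeleton of published theorems with citation tags; proofs where landed; nothing here is a claim about the
Yang–Mills mass gap

THE PRINTED LOCI (verbatim).  p. 394: *"R(U) … is the orthogonal projection onto the subspace of λ satisfying Q′(U)G′(U)λ = 0"* with (3.25) p. 395:
*"Rf = (I − G′Q′\*(Q′G′²Q′\*)⁻¹Q′G′)f"*;  (3.26)–(3.27) p. 395: *"Δ_a = Δ_a(U) = Δ + DRD\* + Q\*aQ … G = G(U) = Δ_a⁻¹"*;  (3.10) p. 392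
(`Δ` = the Hessian `D\*𝒦D + Δ′` of the Wilson action at `U`);  p. 416, Theorem 3.11: *"the operators Δ′_a, G′, (Q′G′²Q′\*)⁻¹, Δ_a, G are positive definite"*.

WHY THIS FILE.  After `B9Thm311DeltaPrimePos` ∕ `B9Thm311PosAtRecordV4` (gen 7), row 17 of the N06 knit at def-Y's v4 record displays exactly ONE clause:
`PosDefTr 1 (deltaAY _ parSymY parBY (GpY _ parSymY) U)` on (3.35).  def-Y's `deltaAY = hessY + gradY ∘ RY ∘ divY + QsY ∘ aY ∘ QY` (`OpsYDeltaA`) is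
(3.26) letter by letter; THIS FILE checks the STRUCTURE print relies on, at the letters and for EVERY `G`-valued background (`G ≤ U(N)`): since
`(Q′G′²Q′\*)(U)` is a unit there (`isUnit_XY_parSymY`, v1.1 of `B9Thm311PosAtRecordV4`), `R(U)` of (3.25) IS an idempotent (`RY_parSymY_idempotent`),
symmetric (`B9Thm311AdjointPairs.RY_isSymmTr`), hence `⟨f, R(U)f⟩ = ‖R(U)f‖² ≥ 0`; with (3.8) (`isAdjTr_gradY_divY`) and (3.13) (`isAdjTr_QY_QsY_parBY`)
the form of `Δ_a(U)` is the Hessian's form plus two squares (`trIP_deltaAY_parSymY_eq`), so `Δ_a(U) ≥ Δ(U)` as forms (`trIP_hessY_le_trIP_deltaAY`):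
the displayed clause is a statement about the small-field Hessian made coercive by gauge fixing and averaging — Theorems 3.3∕3.10's content, as
print says, and nothing else.

* §1 `XinvY_comp_XY_parSymY` ∕ `XY_comp_XinvY_parSymY` (two-sided inverse at every `G`-valued `U`), ★ `RY_parSymY_idempotent`,
  ★ `QpY_GpY_RY_parSymY` (`Q′G′R = 0`) and `RY_apply_of_QpY_GpY_eq_zero` (`R = 1` on `ker Q′G′`) = (3.20)–(3.21) at the letters, `RY_parSymY_isSymmTr`,
  ★ `trIP_RY_parSymY_self` (`⟨f, Rf⟩ = ⟨Rf, Rf⟩`), `trIP_RY_parSymY_self_nonneg`.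
* §2 `trIP_aY_eq` (`⟨Φ, aΦ⟩₁ = ⟨Φ, Φ⟩_w`, `w = i.w > 0`), ★★ `trIP_deltaAY_parSymY_eq` ((3.26) as forms), ★★ `trIP_hessY_le_trIP_deltaAY`,
  `posDefTr_deltaAY_parSymY_of_forms` (the displayed clause, unfolded into its three forms).

HONEST SCOPE.  Finite-dimensional algebra over landed letters; no estimate of [B9] is proved or asserted; NOT a node discharge, NOT summit progress;
count-neutral; nothing continuum, nothing about the mass gap.  Cell `pub-ymgap` (HUMAN RULING D-0062), Track A node N06 [B9], seat `pub-ymgap-dag-n06-j`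
(harness re-seat gen 7), 2026-08-27.
-/

namespace Literature.MathematicalPhysics.QuantumFieldTheory.Balaban1983to89.B9Thm311ProjectionR

open Literature.MathematicalPhysics.QuantumFieldTheory.Balaban1983to89
open B9Thm311Whole B9Thm311ReadingCoords B9Thm311ReadingAtLetters B9Thm311AdjointAtLetters B9Thm311DeltaPrimeSymm B9Thm311InputsAtOne
  B9Thm311AdjointPairs B9Ineq349SiteAdjoint B9Thm311Curv2Symm B9Thm311SymmAtRecordV4 B9Thm311DeltaPrimePos B9Thm311PosAtRecordV4 Node00
open B6KLevelCensusIndexV1 B9PinMembersKLevelV1 B9PinGeometryKLevelV1 B7Prop2SpecialUnitary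
open scoped Matrix

noncomputable section

/-! ## §1 `R(U)` is a symmetric idempotent at every unitary background -/

section Projection

open scoped Matrix.Norms.L2Operator

variable {d ℓ : ℕ} {hd : 1 ≤ d + 1} {hL : Odd (ℓ + 1) ∧ 1 < ℓ + 1} {b₀ b₁ : ℝ} {N : ℕ}
variable (i : KIdx d ℓ hd hL b₀ b₁) {G : Subgroup (Matrix (Fin N) (Fin N) ℂ)ˣ}

/-- `(Q′G′²Q′\*)⁻¹(U) ∘ (Q′G′²Q′\*)(U) = 1` at every `G`-valued configuration, `G ≤ U(N)`. [cite: Balaban1985BackgroundPropagators, (3.25) p.395] -/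
theorem XinvY_comp_XY_parSymY (hG : G ≤ B7Prop2Explicit.unitaryUnits (Matrix (Fin N) (Fin N) ℂ)) {U : CfgY (Matrix (Fin N) (Fin N) ℂ) i}
    (hU : ∀ μ x, U μ x ∈ G) :
    XinvY i (parSymY i) (GpY i (parSymY i)) U ∘ₗ XY i (parSymY i) (GpY i (parSymY i)) U = LinearMap.id :=
  Ring.inverse_mul_cancel _ (isUnit_XY_parSymY i hG hU)

/-- `(Q′G′²Q′\*)(U) ∘ (Q′G′²Q′\*)⁻¹(U) = 1` at every `G`-valued configuration, `G ≤ U(N)`. [cite: Balaban1985BackgroundPropagators, (3.25) p.395] -/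
theorem XY_comp_XinvY_parSymY (hG : G ≤ B7Prop2Explicit.unitaryUnits (Matrix (Fin N) (Fin N) ℂ)) {U : CfgY (Matrix (Fin N) (Fin N) ℂ) i}
    (hU : ∀ μ x, U μ x ∈ G) :
    XY i (parSymY i) (GpY i (parSymY i)) U ∘ₗ XinvY i (parSymY i) (GpY i (parSymY i)) U = LinearMap.id :=
  Ring.mul_inverse_cancel _ (isUnit_XY_parSymY i hG hU)

/-- ★ **(3.25)'s `R(U) = I − G′Q′\*(Q′G′²Q′\*)⁻¹Q′G′` IS AN IDEMPOTENT** at every `G`-valued configuration (print: *"the orthogonal projection onto the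
subspace … Q′(U)G′(U)λ = 0"*): `P = G′Q′\*(Q′G′²Q′\*)⁻¹Q′G′` satisfies `P² = G′Q′\*X⁻¹(Q′G′G′Q′\*)X⁻¹Q′G′ = P`. [cite: Balaban1985BackgroundPropagators, (3.20) p.394, (3.25) p.395] -/
theorem RY_parSymY_idempotent (hG : G ≤ B7Prop2Explicit.unitaryUnits (Matrix (Fin N) (Fin N) ℂ)) {U : CfgY (Matrix (Fin N) (Fin N) ℂ) i}
    (hU : ∀ μ x, U μ x ∈ G) :
    RY i (parSymY i) (GpY i (parSymY i)) U ∘ₗ RY i (parSymY i) (GpY i (parSymY i)) U = RY i (parSymY i) (GpY i (parSymY i)) U := by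
  set Gp := GpY i (parSymY i) U with hGp
  set Qp := QpY i (parSymY i) U
  set Qps := QpsY i (parSymY i) U
  set Xi := XinvY i (parSymY i) (GpY i (parSymY i)) U
  have hkey : Xi ∘ₗ (Qp ∘ₗ (Gp ∘ₗ (Gp ∘ₗ (Qps ∘ₗ (Xi ∘ₗ (Qp ∘ₗ Gp)))))) = Xi ∘ₗ (Qp ∘ₗ Gp) := by
    have h := congrArg (fun S => S ∘ₗ (Xi ∘ₗ (Qp ∘ₗ Gp))) (XinvY_comp_XY_parSymY i hG hU)
    simp only [XY, LinearMap.comp_assoc, LinearMap.id_comp] at h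
    exact h
  have hP : (Gp ∘ₗ (Qps ∘ₗ (Xi ∘ₗ (Qp ∘ₗ Gp)))) ∘ₗ (Gp ∘ₗ (Qps ∘ₗ (Xi ∘ₗ (Qp ∘ₗ Gp)))) = Gp ∘ₗ (Qps ∘ₗ (Xi ∘ₗ (Qp ∘ₗ Gp))) := by
    simp only [LinearMap.comp_assoc]
    rw [hkey]
  have hR : RY i (parSymY i) (GpY i (parSymY i)) U = LinearMap.id - Gp ∘ₗ (Qps ∘ₗ (Xi ∘ₗ (Qp ∘ₗ Gp))) := rfl
  rw [hR, LinearMap.sub_comp, LinearMap.id_comp, LinearMap.comp_sub, LinearMap.comp_id, hP, sub_self, sub_zero]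

/-- ★ **(3.20)–(3.21) AT THE LETTERS, first half: `Q′(U)G′(U)R(U) = 0`** — the range of `R(U)` lies in the subspace `{λ : Q′G′λ = 0}` (print p.394), at
every `G`-valued configuration. [cite: Balaban1985BackgroundPropagators, (3.20)–(3.21) p.394, (3.25) p.395] -/
theorem QpY_GpY_RY_parSymY (hG : G ≤ B7Prop2Explicit.unitaryUnits (Matrix (Fin N) (Fin N) ℂ)) {U : CfgY (Matrix (Fin N) (Fin N) ℂ) i}
    (hU : ∀ μ x, U μ x ∈ G) :
    QpY i (parSymY i) U ∘ₗ GpY i (parSymY i) U ∘ₗ RY i (parSymY i) (GpY i (parSymY i)) U = 0 := by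
  set Gp := GpY i (parSymY i) U
  set Qp := QpY i (parSymY i) U
  set Qps := QpsY i (parSymY i) U
  set Xi := XinvY i (parSymY i) (GpY i (parSymY i)) U
  have hkey : Qp ∘ₗ (Gp ∘ₗ (Gp ∘ₗ (Qps ∘ₗ (Xi ∘ₗ (Qp ∘ₗ Gp))))) = Qp ∘ₗ Gp := by
    have h := congrArg (fun S => S ∘ₗ (Qp ∘ₗ Gp)) (XY_comp_XinvY_parSymY i hG hU)
    simp only [XY, LinearMap.comp_assoc, LinearMap.id_comp] at h
    exact h
  have hR : RY i (parSymY i) (GpY i (parSymY i)) U = LinearMap.id - Gp ∘ₗ (Qps ∘ₗ (Xi ∘ₗ (Qp ∘ₗ Gp))) := rfl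
  rw [hR, LinearMap.comp_sub, LinearMap.comp_sub, LinearMap.comp_id, hkey, sub_self]

/-- ★ **(3.20)–(3.21), second half: `R(U)λ = λ` whenever `Q′(U)G′(U)λ = 0`** — `R(U)` is the identity on that subspace (any transporter table, any letter `G′`;
no invertibility needed). [cite: Balaban1985BackgroundPropagators, (3.20)–(3.21) p.394, (3.25) p.395] -/
theorem RY_apply_of_QpY_GpY_eq_zero (parS : SiteParY (Matrix (Fin N) (Fin N) ℂ) i) (Gp : SiteOpY (Matrix (Fin N) (Fin N) ℂ) i)
    (U : CfgY (Matrix (Fin N) (Fin N) ℂ) i) {lam : SiteY i → Matrix (Fin N) (Fin N) ℂ} (h : QpY i parS U (Gp U lam) = 0) :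
    RY i parS Gp U lam = lam := by
  rw [RY, LinearMap.sub_apply, LinearMap.id_apply, LinearMap.comp_apply, LinearMap.comp_apply, LinearMap.comp_apply, LinearMap.comp_apply, h,
    map_zero, map_zero, map_zero, sub_zero]

/-- `R(U)` is symmetric for the site trace pairing at the v4 letters (gen 6's `RY_isSymmTr` with its two inputs now theorems).
[cite: Balaban1985BackgroundPropagators, (3.20) p.394, (3.25) p.395] -/
theorem RY_parSymY_isSymmTr (hG : G ≤ B7Prop2Explicit.unitaryUnits (Matrix (Fin N) (Fin N) ℂ)) {U : CfgY (Matrix (Fin N) (Fin N) ℂ) i}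
    (hU : ∀ μ x, U μ x ∈ G) : IsSymmTr (fun _ => (1 : ℝ)) (RY i (parSymY i) (GpY i (parSymY i)) U) :=
  RY_isSymmTr i (parSymY i) (GpY i (parSymY i)) U (GpY_isSymmTr i (parSymY i) U (symm0_parSymY i hG hU)) (adj_parSymY i hG hU)

/-- ★ **`⟨f, R(U)f⟩ = ⟨R(U)f, R(U)f⟩`** — a symmetric idempotent is an orthogonal projection for the trace pairing.
[cite: Balaban1985BackgroundPropagators, (3.20) p.394 («orthogonal projection»), (3.25) p.395] -/
theorem trIP_RY_parSymY_self (hG : G ≤ B7Prop2Explicit.unitaryUnits (Matrix (Fin N) (Fin N) ℂ)) {U : CfgY (Matrix (Fin N) (Fin N) ℂ) i}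
    (hU : ∀ μ x, U μ x ∈ G) (f : SiteY i → Matrix (Fin N) (Fin N) ℂ) :
    trIP (fun _ => (1 : ℝ)) f (RY i (parSymY i) (GpY i (parSymY i)) U f)
      = trIP (fun _ => (1 : ℝ)) (RY i (parSymY i) (GpY i (parSymY i)) U f) (RY i (parSymY i) (GpY i (parSymY i)) U f) := by
  have h := RY_parSymY_isSymmTr i hG hU f (RY i (parSymY i) (GpY i (parSymY i)) U f)
  rw [← LinearMap.comp_apply, RY_parSymY_idempotent i hG hU] at h
  exact h.symm

/-- hence `⟨f, R(U)f⟩ ≥ 0`. [cite: Balaban1985BackgroundPropagators, (3.20) p.394, (3.25) p.395] -/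
theorem trIP_RY_parSymY_self_nonneg (hG : G ≤ B7Prop2Explicit.unitaryUnits (Matrix (Fin N) (Fin N) ℂ))
    {U : CfgY (Matrix (Fin N) (Fin N) ℂ) i} (hU : ∀ μ x, U μ x ∈ G) (f : SiteY i → Matrix (Fin N) (Fin N) ℂ) :
    0 ≤ trIP (fun _ => (1 : ℝ)) f (RY i (parSymY i) (GpY i (parSymY i)) U f) := by
  rw [trIP_RY_parSymY_self i hG hU]
  exact trIP_self_nonneg _ (fun _ => one_pos) _

end Projection

/-! ## §2 (3.26) as quadratic forms: `⟨A, Δ_a(U)A⟩ = ⟨A, Δ(U)A⟩ + ‖R(U)D*_UA‖² + ‖Q(U)A‖²_a` -/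

section Forms

open scoped Matrix.Norms.L2Operator

variable {d ℓ : ℕ} {hd : 1 ≤ d + 1} {hL : Odd (ℓ + 1) ∧ 1 < ℓ + 1} {b₀ b₁ : ℝ} {N : ℕ}
variable (i : KIdx d ℓ hd hL b₀ b₁) {G : Subgroup (Matrix (Fin N) (Fin N) ℂ)ˣ}

/-- the weight operator `a` of (3.26) is the multiplication by def-Y's positive weights `i.w`: `⟨Φ, aΦ⟩₁ = ⟨Φ, Φ⟩_w`.
[cite: Balaban1985BackgroundPropagators, (3.26) p.395; Balaban1984PropagatorsII, (2.18)–(2.20) p.226] -/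
theorem trIP_aY_eq (Φ : IBondY i → Matrix (Fin N) (Fin N) ℂ) : trIP (fun _ => (1 : ℝ)) Φ (aY i Φ) = trIP i.w Φ Φ := by
  rw [trIP_eq_re_trace, trIP_eq_re_trace]
  refine Finset.sum_congr rfl fun ι _ => ?_
  rw [aY, aK_eq_diagonal, liftMatY_diagonal_apply, Matrix.mul_smul, Matrix.trace_smul, smul_eq_mul, Complex.re_ofReal_mul, one_mul]

/-- ★★ **(3.26) AS QUADRATIC FORMS AT THE v4 LETTERS**: for every `G`-valued configuration (`G ≤ U(N)`)
`⟨A, Δ_a(U)A⟩₁ = ⟨A, Δ(U)A⟩₁ + ⟨D\*_UA, R(U)D\*_UA⟩₁ + ⟨Q(U)A, Q(U)A⟩_w` — by (3.8) (`D` adjoint to `D\*`) and (3.13) (`Q\*` adjoint to `Q`).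
[cite: Balaban1985BackgroundPropagators, (3.26) p.395, (3.8) p.392, (3.13) p.393] -/
theorem trIP_deltaAY_parSymY_eq (hG : G ≤ B7Prop2Explicit.unitaryUnits (Matrix (Fin N) (Fin N) ℂ)) {U : CfgY (Matrix (Fin N) (Fin N) ℂ) i}
    (hU : ∀ μ x, U μ x ∈ G) (A : FBondY i → Matrix (Fin N) (Fin N) ℂ) :
    trIP (fun _ => (1 : ℝ)) A (deltaAY i (parSymY i) (parBY i) (GpY i (parSymY i)) U A)
      = trIP (fun _ => (1 : ℝ)) A (hessY i U A)
        + trIP (fun _ => (1 : ℝ)) (divY i U A) (RY i (parSymY i) (GpY i (parSymY i)) U (divY i U A))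
        + trIP i.w (QY i (parBY i) U A) (QY i (parBY i) U A) := by
  have hU' : ∀ μ x, ((U μ x : (Matrix (Fin N) (Fin N) ℂ)ˣ) : Matrix (Fin N) (Fin N) ℂ) ∈ unitary (Matrix (Fin N) (Fin N) ℂ) :=
    fun μ x => hG (hU μ x)
  rw [deltaAY, LinearMap.add_apply, LinearMap.add_apply, trIP_add_right, trIP_add_right]
  congr 1
  · congr 1
    rw [LinearMap.comp_apply, LinearMap.comp_apply, trIP_comm, isAdjTr_gradY_divY i U hU', trIP_comm]
  · rw [LinearMap.comp_apply, LinearMap.comp_apply, ← isAdjTr_QY_QsY_parBY i hG U hU, trIP_aY_eq]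

/-- ★★ **`Δ_a(U) ≥ Δ(U)` AS FORMS** at every `G`-valued configuration: the gauge-fixing term `DR(U)D\*` and the averaging term `Q\*aQ` of (3.26) contribute
the SQUARES `‖R(U)D\*_UA‖²` and `‖Q(U)A‖²_w`.  (So the positivity row 17 still displays is a statement about the Wilson Hessian `Δ(U)` made coercive by these
two squares — Theorems 3.3∕3.10.) [cite: Balaban1985BackgroundPropagators, (3.26) p.395, Thm 3.11 p.416] -/
theorem trIP_hessY_le_trIP_deltaAY (hG : G ≤ B7Prop2Explicit.unitaryUnits (Matrix (Fin N) (Fin N) ℂ)) {U : CfgY (Matrix (Fin N) (Fin N) ℂ) i}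
    (hU : ∀ μ x, U μ x ∈ G) (A : FBondY i → Matrix (Fin N) (Fin N) ℂ) :
    trIP (fun _ => (1 : ℝ)) A (hessY i U A) ≤ trIP (fun _ => (1 : ℝ)) A (deltaAY i (parSymY i) (parBY i) (GpY i (parSymY i)) U A) := by
  rw [trIP_deltaAY_parSymY_eq i hG hU A, add_assoc]
  exact le_add_of_nonneg_right (add_nonneg (trIP_RY_parSymY_self_nonneg i hG hU _) (trIP_self_nonneg _ i.hw _))

/-- the displayed clause of row 17, UNFOLDED: `Δ_a(U)` is positive definite iff the three forms of (3.26) have positive sum on `A ≠ 0` — recorded as the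
sufficient direction the knit would use. [cite: Balaban1985BackgroundPropagators, (3.26) p.395, Thm 3.11 p.416] -/
theorem posDefTr_deltaAY_parSymY_of_forms (hG : G ≤ B7Prop2Explicit.unitaryUnits (Matrix (Fin N) (Fin N) ℂ)) {U : CfgY (Matrix (Fin N) (Fin N) ℂ) i}
    (hU : ∀ μ x, U μ x ∈ G)
    (h : ∀ A : FBondY i → Matrix (Fin N) (Fin N) ℂ, A ≠ 0 →
      0 < trIP (fun _ => (1 : ℝ)) A (hessY i U A)
        + trIP (fun _ => (1 : ℝ)) (divY i U A) (RY i (parSymY i) (GpY i (parSymY i)) U (divY i U A))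
        + trIP i.w (QY i (parBY i) U A) (QY i (parBY i) U A)) :
    PosDefTr (fun _ => (1 : ℝ)) (deltaAY i (parSymY i) (parBY i) (GpY i (parSymY i)) U) := fun A hA => by
  rw [trIP_deltaAY_parSymY_eq i hG hU A]
  exact h A hA

end Forms

end

end Literature.MathematicalPhysics.QuantumFieldTheory.Balaban1983to89.B9Thm311ProjectionR
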